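import Literature.Topology.FourManifolds.ZeroSurgeryHomotopyBallSliceHolds
import Literature.Topology.FourManifolds.ZeroSurgeryHomotopyBallSliceProofs
import Literature.Topology.FourManifolds.SliceDiscInTransport
import Literature.Topology.FourManifolds.SPC4Wave0Proofs
import Literature.Topology.FourManifolds.ClosedBallProofs
import HarnessLib

/-!
# Stub `stub_pairSphereData` of line `embed-dont-dissolve` for crux `ZeroSurgeryExotic.ZseSVanishesOnPairs`
(item stmt-SmoothPoincare4-0368, route route-SmoothPoincare4-ZeroSurgeryExotic)

**The Manolescu–Piccirillo pair-sphere datum.**  On a `0`-surgery pair `(K, K', Y)` with `K` smoothly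
slice there are: a slice disc `g` of `K`, a closed smooth `4`-manifold `X ≃ₕ S⁴`, slice data `(e, f)` for
`K'` in `X`, a smooth embedding `j` of the open slice-disc exterior `B̊⁴ ∖ g(𝔻²)` onto the complement of
`e(𝔻⁴) ∪ f(𝔻²)`, and a point `q` off `e(ℝ⁴) ∪ f(ℝ²)`.

Proof (Manolescu–Piccirillo 2023, §3.2, proof of Lemma 3.3 for `W = S⁴`), entirely over proved tree
theorems:

* `K.IsSmoothlySlice` is `∃ g, K.IsSliceDisc g`.
* `pairSphere_core`: the glued manifold `X = X(K') ∪_Y (B̊⁴ ∖ Δ)` — the simply connected open trace of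
  `K'` (`Knot.exists_simplyConnected_openTrace_of_isIntegralSurgery`) glued to the open slice-disc
  exterior along the proved end collar (`Knot.IsSliceDisc.exists_endCollar_of_isIntegralSurgery_zero_holds`)
  by `SmoothGlueData.ofCollars` — is closed, simply connected
  (`simplyConnectedSpace_ofCollars_sliceDiscExterior`), carries the slice data `(inl ∘ e, inl ∘ f)` and
  the open embedding `j = inr` with `range j = (e(𝔻⁴) ∪ f(𝔻²))ᶜ`.  This is the proof of the tree's
  `Knot.ManolescuPiccirillo2023_lemma33_sphere_core_of_endCollar` with the embedding `j` kept in the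
  conclusion.
* `H₂(X; ℤ) = 0` by `Knot.isZero_singularHomologyZ_two_of_isSliceDiscIn_of_range_eq_holds`, hence
  `X ≃ₕ S⁴` by `nonempty_homotopyEquiv_sphere_four_iff_holds` (Whitehead step).
* The point `q`: `Knot.IsSliceDiscIn.exists_notMem_range` moves the slice data off any point by a
  diffeomorphism `φ` of `X` after shrinking the ball to `e'` (`e' = e` on `B(0, 8) ⊇ 𝔻⁴`); the
  embedding `φ ∘ j` (`Manifold.IsSmoothEmbedding.diffeomorph_comp`) still has range
  `((φ ∘ e')(𝔻⁴) ∪ (φ ∘ f)(𝔻²))ᶜ` because `φ` is a bijection and `e'(𝔻⁴) = e(𝔻⁴)`.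
-/

noncomputable section

-- the prescribed namespace `Summit.<P>.<Sub>.…` duplicates `SmoothPoincare4` (P = Sub)
set_option linter.dupNamespace false

open scoped Manifold ContDiff Topology
open Set Function ContinuousMap
open Literature.Topology.FourManifolds

namespace Summit.SmoothPoincare4.SmoothPoincare4.Theorems.ZseSVanishesOnPairs

/-- Local notation: the model space `ℝⁿ`. -/
local notation "𝔼 " n:arg => EuclideanSpace ℝ (Fin n)
/-- Local notation: the round 4-sphere. -/
local notation "𝕊⁴" => (Metric.sphere (0 : EuclideanSpace ℝ (Fin 5)) 1)

/-- **Manolescu–Piccirillo's `X = X(K') ∪_Y V` with its embedding of `int V` kept.**  For knots `K, K'`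
with a common `0`-surgery `Y` and a slice disc `g` of `K`, the open trace of `K'` glued to the open
slice-disc exterior `B̊⁴ ∖ g(𝔻²)` along collars of `Y` is a closed smooth simply connected `4`-manifold
`X` carrying slice data `(e, f)` for `K'` and a smooth embedding `j` of `B̊⁴ ∖ g(𝔻²)` onto
`X ∖ (e(𝔻⁴) ∪ f(𝔻²))` (the proof of `Knot.ManolescuPiccirillo2023_lemma33_sphere_core_of_endCollar`,
conclusion enlarged by `j`). [cite: ManolescuPiccirillo2023, §3.2, proof of Lemma 3.3] -/
theorem pairSphere_core (K K' : Knot) (Y : Type) [TopologicalSpace Y] [ChartedSpace (𝔼 3) Y]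
    (hK : IsIntegralSurgery (𝓡 3) Y K 0) (hK' : IsIntegralSurgery (𝓡 3) Y K' 0)
    (g : 𝔼 2 → 𝔼 4) (hg : K.IsSliceDisc g) :
    ∃ (X : Type) (_ : TopologicalSpace X) (_ : T2Space X) (_ : SecondCountableTopology X)
      (_ : ChartedSpace (𝔼 4) X) (_ : IsManifold (𝓡 4) ∞ X) (_ : CompactSpace X)
      (e : 𝔼 4 → X) (f : 𝔼 2 → X) (j : sliceDiscExterior g → X),
      SimplyConnectedSpace X ∧ K'.IsSliceDiscIn X e f ∧ Manifold.IsSmoothEmbedding (𝓡 4) (𝓡 4) ∞ j ∧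
        range j = (e '' Metric.closedBall (0 : 𝔼 4) 1 ∪ f '' Metric.closedBall (0 : 𝔼 2) 1)ᶜ := by
  obtain ⟨T, _, _, _, _, _, e, f, cT, hef, hsT, hcT, hcT', htT, hKT, hclT⟩ :=
    Knot.exists_simplyConnected_openTrace_of_isIntegralSurgery K' 0 Y hK'
  obtain ⟨cV, hsV, hcV, hcV', hclV, hKV⟩ :=
    Knot.IsSliceDisc.exists_endCollar_of_isIntegralSurgery_zero_holds K Y hK g hg
  haveI : PathConnectedSpace Y := pathConnectedSpace_of_isIntegralSurgery hK
  -- the compact core `C = e(𝔻⁴) ∪ f(𝔻²)` of the trace side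
  set C : Set T := e '' Metric.closedBall (0 : 𝔼 4) 1 ∪ f '' Metric.closedBall (0 : 𝔼 2) 1 with hC
  have hCt : cT.targetᶜ = C := by rw [htT, compl_compl]
  -- the gluing datum and the glued manifold
  let d : SmoothGlueData (𝓡 4) (𝓡 4) T (sliceDiscExterior g) (𝔼 4) :=
    SmoothGlueData.ofCollars cT cV hsT hsV hcT hcT' hcV hcV' (ContinuousLinearEquiv.refl ℝ _)
      (ContinuousLinearEquiv.refl ℝ _)
  haveI : T2Space d.Glued :=
    SmoothGlueData.t2Space_ofCollars (s := fun p : Y × ℝ ↦ p.2) continuous_snd hclT hclV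
  haveI : CompactSpace d.Glued := by
    refine SmoothGlueData.compactSpace_ofCollars (fun p : Y × ℝ ↦ p.2) ?_ (hKV 0)
    rw [hCt]
    exact hKT 0
  haveI : SecondCountableTopology d.Glued := d.secondCountableTopology
  have hcore : IsCompact cV.targetᶜ :=
    (hKV 0).of_isClosed_subset cV.open_target.isClosed_compl subset_union_left
  have hπ : SimplyConnectedSpace d.Glued :=
    simplyConnectedSpace_ofCollars_sliceDiscExterior hg hcore
  -- the differential of `inl` is injective (it is an immersion)
  have himm : ∀ x, Injective (mfderiv (𝓡 4) (𝓡 4) d.inl x) := by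
    obtain ⟨F, _, _, hF⟩ := d.isSmoothEmbedding_inl.isImmersion
    exact fun x ↦ Manifold.IsImmersionAtOfComplement.mfderiv_injective (hF x) (by simp)
  have hef' : K'.IsSliceDiscIn d.Glued (d.inl ∘ e) (d.inl ∘ f) :=
    hef.comp_of_injective d.inl_injective d.contMDiff_inl himm
      (d.isSmoothEmbedding_inl_comp hef.isSmoothEmbedding)
  have hrange : range d.inr =
      ((d.inl ∘ e) '' Metric.closedBall (0 : 𝔼 4) 1 ∪ (d.inl ∘ f) '' Metric.closedBall (0 : 𝔼 2) 1)ᶜ := by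
    rw [SmoothGlueData.range_inr_ofCollars, hCt, hC, image_union, image_comp, image_comp]
  exact ⟨d.Glued, inferInstance, inferInstance, inferInstance, inferInstance, inferInstance,
    inferInstance, d.inl ∘ e, d.inl ∘ f, d.inr, hπ, hef', d.isSmoothEmbedding_inr, hrange⟩

/-- **Pair-sphere data (stub `stub_pairSphereData` of line `embed-dont-dissolve`).**  On a `0`-surgery
pair `(K, K', Y)` with `K` smoothly slice there is a Manolescu–Piccirillo pair-sphere datum: a slice disc
`g` of `K`, a closed smooth `X ≃ₕ S⁴`, slice data `(e, f)` for `K'` in `X`, a smooth embedding `j` of the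
open slice-disc exterior `B̊⁴ ∖ g(𝔻²)` onto the complement of `e(𝔻⁴) ∪ f(𝔻²)`, and a point `q` off
`e(ℝ⁴) ∪ f(ℝ²)`.  The glued `X = X(K') ∪_Y V` of `pairSphere_core` is simply connected and has
`H₂(X; ℤ) = 0` (`Knot.isZero_singularHomologyZ_two_of_isSliceDiscIn_of_range_eq_holds`), so `X ≃ₕ S⁴`
(`nonempty_homotopyEquiv_sphere_four_iff_holds`, the Whitehead step of the source); the slice data are
then moved off a point by an ambient diffeomorphism `φ` after shrinking the ball
(`Knot.IsSliceDiscIn.exists_notMem_range`), and `j` is replaced by `φ ∘ j`.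
[cite: ManolescuPiccirillo2023, §3.2, proof of Lemma 3.3] -/
theorem stub_pairSphereData :
    ∀ (K K' : Knot) (Y : Type) [TopologicalSpace Y] [ChartedSpace (𝔼 3) Y],
      IsIntegralSurgery (𝓡 3) Y K 0 → IsIntegralSurgery (𝓡 3) Y K' 0 → K.IsSmoothlySlice →
      ∃ (g : 𝔼 2 → 𝔼 4) (X : Type) (_ : TopologicalSpace X) (_ : T2Space X) (_ : SecondCountableTopology X)
        (_ : ChartedSpace (𝔼 4) X) (_ : IsManifold (𝓡 4) ∞ X) (_ : CompactSpace X)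
        (e : 𝔼 4 → X) (f : 𝔼 2 → X) (j : sliceDiscExterior g → X) (q : X),
        Nonempty (X ≃ₕ 𝕊⁴) ∧ K.IsSliceDisc g ∧ K'.IsSliceDiscIn X e f ∧
          Manifold.IsSmoothEmbedding (𝓡 4) (𝓡 4) ∞ j ∧
          range j = (e '' Metric.closedBall (0 : 𝔼 4) 1 ∪ f '' Metric.closedBall (0 : 𝔼 2) 1)ᶜ ∧
          q ∉ range e ∧ q ∉ range f := by
  intro K K' Y _ _ hK hK' hsl
  obtain ⟨g, hg⟩ := hsl
  obtain ⟨X, _, _, _, _, _, _, e, f, j, hπ, hef, hj, hrange⟩ := pairSphere_core K K' Y hK hK' g hg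
  -- `H₂(X; ℤ) = 0`, hence `X ≃ₕ S⁴`
  have hH := Knot.isZero_singularHomologyZ_two_of_isSliceDiscIn_of_range_eq_holds K K' g hg X e f j
    hef hj hrange
  have hX : Nonempty (X ≃ₕ 𝕊⁴) := (nonempty_homotopyEquiv_sphere_four_iff_holds X).2 ⟨hπ, hH⟩
  -- move the slice data off a point
  haveI : SimplyConnectedSpace X := hπ
  obtain ⟨φ, e', -, hφ, hee', he0, hf0⟩ := hef.exists_notMem_range (e 0)
  refine ⟨g, X, _, ‹_›, ‹_›, _, ‹_›, ‹_›, φ ∘ e', φ ∘ f, φ ∘ j, e 0, hX, hg, hφ,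
    hj.diffeomorph_comp φ, ?_, he0, hf0⟩
  -- the range identity persists
  have hball : (φ ∘ e') '' Metric.closedBall (0 : 𝔼 4) 1 = φ '' (e '' Metric.closedBall (0 : 𝔼 4) 1) := by
    rw [image_comp]
    congr 1
    refine Subset.antisymm ?_ ?_
    · rintro _ ⟨w, hw, rfl⟩
      exact ⟨w, hw, (hee' w (by rw [mem_closedBall_zero_iff] at hw; linarith)).symm⟩
    · rintro _ ⟨w, hw, rfl⟩
      exact ⟨w, hw, hee' w (by rw [mem_closedBall_zero_iff] at hw; linarith)⟩
  rw [range_comp, hrange, image_compl_eq (EquivLike.bijective φ), image_union, hball, image_comp φ f]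

end Summit.SmoothPoincare4.SmoothPoincare4.Theorems.ZseSVanishesOnPairs

end
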